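import Summits.QuantumFields.YangMills.Theses.SlackWindow
import Summits.QuantumFields.YangMills.Theorems.SquareRootCeilingsMirrorDomination
import Summits.QuantumFields.YangMills.Theorems.SquareRootCeilingsDominationTransfer

/-!
# Route `SlackWindow` — the support `CarrierSlackLargeTransfer` (rev 4, ym-idea-11 g10 LINE 3 «carrier slack»), PROVED

`CarrierSlackLargeTransfer : SqrtDominationC → CarrierSlackLargeMirrorCeiling → (carrier large-volume slack ceilings)`
(item stmt-QuantumFields-23687).  Verbatim the landed `slackLargeTransfer_proof` (Theorems/SlackWindowSlackLargeTransfer.lean)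
with ONE extra hypothesis threaded to the mirror crux: the unit `s` is a CARRIER (the two floors hold at `s` itself), which
is exactly where the calibration (`slackCalibration_proof`, `slackLargeCalibration_proof`) consumes the ceilings.  Why the
re-typing: in `SlackMirrorCeiling` / `SlackLargeMirrorCeiling` (stmt-QuantumFields-23500 / 23559) the slack factor
`((R s)⁻¹)^σ` is vacuous — sub-onset-ness is upward-closed in `s` and the covariance is `s`-free, so the ceiling can be read
at `s₁ = min(ℓ₄,1)/R` (Theorems/SlackWindowSlackVacuity.lean: `SlackMirrorCeiling → SquareRootCeilings.AxisMirrorCeiling`);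
restricted to carriers `s ∈ (s⋆/2, s⋆]` the factor is a genuine UV gain `≍ (R_onset/R)^σ`.

Also the two edges: `carrierSlackLargeMirrorCeiling_of_slackLargeMirrorCeiling` (23559 ⇒ 23686, drop the hypothesis) and
`slackLargeCalibration_of_carrier` (23688 ⇒ 23561, restrict the ceilings hypothesis to carriers).

HONEST LABEL: glue only.  `CarrierSlackLargeMirrorCeiling`, `SqrtDominationC` and `FloorsCond` stay OPEN; no summit,
leaf (R2a-IV) or NT statement is proved; the YM mass gap is NOT proved.  Planner ym-idea-11 g10.

References: K. Osterwalder, E. Seiler, Ann. Phys. 110 (1978) 440, §2; J. Fröhlich, R. Israel, E. Lieb, B. Simon,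
CMP 62 (1978) 1, Thm. 2.1.
-/

set_option autoImplicit false

noncomputable section

namespace Summit.QuantumFields.YangMills.Theorems.SlackWindow

open MeasureTheory
open Literature.MathematicalPhysics.QuantumFieldTheory Literature.MathematicalPhysics.QuantumLattice
open Summit.QuantumFields.YangMills.Cruxes.OSLegsFromFemtoAndGap.DlrCollarTransfer
open Summit.QuantumFields.YangMills.Theses.SlackWindow

/-- **Support `CarrierSlackLargeTransfer` of route `SlackWindow`** (rev 4, stmt-QuantumFields-23687): √-domination × RP-mirror
transfer with the UV slack read only at CARRIER units (sub-onset AND floors at `s`).  Glue only. -/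
theorem carrierSlackLargeTransfer_proof :
    Summit.QuantumFields.YangMills.Theses.SlackWindow.CarrierSlackLargeTransfer := by
  intro hK2 hM G _ _ _ _ hG hSU
  letI : MeasurableSpace G := borel G
  haveI : BorelSpace G := ⟨rfl⟩
  intro r v f g h Λ₅
  obtain ⟨ε₀, hε₀, H1⟩ := hM G hG hSU r v f g h Λ₅
  refine ⟨ε₀, hε₀, fun ε hε hεle hfl => ?_⟩
  obtain ⟨σ, C₁, ℓ₄, β₄, hℓ₄, hC₁, H1'⟩ := H1 ε hε hεle hfl
  obtain ⟨C₂, θ, β₄', hC₂, hθ, H2⟩ := hK2 G hG hSU r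
  refine ⟨σ, C₂ * C₁, θ, ℓ₄, max (max β₄ β₄') 0, hℓ₄, mul_nonneg hC₂ hC₁, hθ, ?_⟩
  intro β hβ
  have hβ₁ : β₄ ≤ β := le_trans (le_trans (le_max_left _ _) (le_max_left _ _)) hβ
  have hβ₂ : β₄' ≤ β := le_trans (le_trans (le_max_right _ _) (le_max_left _ _)) hβ
  have hβ0 : (0 : ℝ) ≤ β := le_trans (le_max_right _ _) hβ
  obtain ⟨L₀, H1''⟩ := H1' β hβ₁
  refine ⟨L₀, ?_⟩
  intro s hs hs1 hsub hcar L n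
  rcases n with _ | _ | m
  · -- n = 0 : empty product
    intro q x R _ _ _ _ _ _
    simp [Summit.QuantumFields.YangMills.Cruxes.UVSeamRec.ResponsePinning.torusE_const]
  · -- n = 1 : a centred one-point function vanishes
    intro q x R _ _ _ _ _ _
    have hslk : (0 : ℝ) ≤ (((R : ℝ) * s)⁻¹) ^ σ := pow_nonneg (inv_nonneg.mpr (by positivity)) _
    have h0 : (0 : ℝ) ≤ (C₂ * C₁ * (((0 + 1 : ℕ) : ℝ)) ^ θ / (R : ℝ) ^ 4 * (((R : ℝ) * s)⁻¹) ^ σ) ^ (0 + 1) := by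
      positivity
    simpa [Fin.prod_univ_one, Summit.QuantumFields.YangMills.Theses.SquareRootCeilings.torusE_plane_centred] using h0
  · -- n = m + 2 ≥ 2 : the mirror ceiling dominates every separated pair (RP), K2 gives the square-root gain
    intro q x R hq hR hRs hRL hL₀ hsep
    set a : ℝ := C₁ / (R : ℝ) ^ 4 * (((R : ℝ) * s)⁻¹) ^ σ with ha
    have ha0 : 0 ≤ a := by
      have hslk : (0 : ℝ) ≤ (((R : ℝ) * s)⁻¹) ^ σ := pow_nonneg (inv_nonneg.mpr (by positivity)) _
      exact mul_nonneg (div_nonneg hC₁ (pow_nonneg (Nat.cast_nonneg _) _)) hslk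
    set b : ℝ := a ^ 2 with hb
    have hb0 : 0 ≤ b := sq_nonneg _
    -- the mirror ceiling along the time axis, read at this (β, s, L, R)
    have hmirror : ∀ (q₁ : Fin 4 × Fin 4) (t : ℕ), q₁.1 < q₁.2 → 2 * R + 2 ≤ t → t ≤ L →
        |torusE G r β L (fun U =>
            (plane G r q₁ (fun i => if i = 0 then ((t : ℕ) : ℤ) else 0) U -
                torusE G r β L (plane G r q₁ (fun i => if i = 0 then ((t : ℕ) : ℤ) else 0))) *
              (plane G r q₁ (fun _ => 0) U - torusE G r β L (plane G r q₁ (fun _ => 0))))| ≤ b :=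
      fun q₁ t hq₁ ht htL => H1'' s hs hs1 hsub hcar L q₁ R t hq₁ hR hRs hRL hL₀ ht htL
    -- RP mirror domination: every (2R+4)-separated single-plane pair obeys the same bound
    have hpairs : ∀ (q q' : Fin 4 × Fin 4) (x y : Fin 4 → ℤ), q.1 < q.2 → q'.1 < q'.2 →
        (∃ k : Fin 4, (2 * (R : ℤ) + 4) ≤ |((((x k - y k : ℤ) : ZMod (2 * L + 1))).valMinAbs : ℤ)|) →
        |torusE G r β L (fun U => (plane G r q x U - torusE G r β L (plane G r q x)) *
          (plane G r q' y U - torusE G r β L (plane G r q' y)))| ≤ b := by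
      intro q q' x y hq hq' hk
      obtain ⟨k, hk⟩ := hk
      exact Summit.QuantumFields.YangMills.Theorems.MirrorDomination.abs_cov_le_of_axisMirror G r hβ0 hR hRL
        hmirror hq hq' x y k hk
    have hsqrt : Real.sqrt b = a := by rw [hb, Real.sqrt_sq ha0]
    have key := H2 β hβ₂ L R b hR hRL hb0 hpairs (m + 2) q x hq (by omega) hsep
    calc |torusE G r β L (fun U => ∏ i, (plane G r (q i) (x i) U - torusE G r β L (plane G r (q i) (x i))))|
        ≤ (C₂ * ((m + 2 : ℕ) : ℝ) ^ θ * Real.sqrt b) ^ (m + 2) := key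
      _ = (C₂ * C₁ * ((m + 2 : ℕ) : ℝ) ^ θ / (R : ℝ) ^ 4 * (((R : ℝ) * s)⁻¹) ^ σ) ^ (m + 2) := by
          rw [hsqrt, ha]; ring



/-- edge: LINE 2's crux (stmt-QuantumFields-23559) gives LINE 3's (drop the carrier hypothesis). -/
theorem carrierSlackLargeMirrorCeiling_of_slackLargeMirrorCeiling (h : SlackLargeMirrorCeiling) :
    CarrierSlackLargeMirrorCeiling := by
  intro G _ _ _ _ hG hSU
  letI : MeasurableSpace G := borel G
  haveI : BorelSpace G := ⟨rfl⟩
  intro r v f g h' Λ₅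
  obtain ⟨ε₀, hε₀, h1⟩ := h G hG hSU r v f g h' Λ₅
  refine ⟨ε₀, hε₀, fun ε hε hεε hfl => ?_⟩
  obtain ⟨σ, C, ℓ₄, β₄, hℓ₄, hC, h2⟩ := h1 ε hε hεε hfl
  refine ⟨σ, C, ℓ₄, β₄, hℓ₄, hC, fun β hβ => ?_⟩
  obtain ⟨L₀, h3⟩ := h2 β hβ
  exact ⟨L₀, fun s hs hs1 hsub _ L q R t hq hR hRs hRL hL₀ ht htL => h3 s hs hs1 hsub L q R t hq hR hRs hRL hL₀ ht htL⟩

/-- edge: LINE 3's calibration twin gives LINE 2's (restrict the ceilings hypothesis to carriers). -/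
theorem slackLargeCalibration_of_carrier (h : CarrierSlackLargeCalibration) : SlackLargeCalibration := by
  intro hK hF
  refine h ?_ hF
  intro G _ _ _ _ hG hSU
  letI : MeasurableSpace G := borel G
  haveI : BorelSpace G := ⟨rfl⟩
  intro r v f g h' Λ₅
  obtain ⟨ε₀, hε₀, h1⟩ := hK G hG hSU r v f g h' Λ₅
  refine ⟨ε₀, hε₀, fun ε hε hεε hfl => ?_⟩
  obtain ⟨σ, C, κ, ℓ₄, β₄, hℓ₄, hC, hκ, h2⟩ := h1 ε hε hεε hfl
  refine ⟨σ, C, κ, ℓ₄, β₄, hℓ₄, hC, hκ, fun β hβ => ?_⟩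
  obtain ⟨L₀, h3⟩ := h2 β hβ
  exact ⟨L₀, fun s hs hs1 hsub _ => h3 s hs hs1 hsub⟩

end Summit.QuantumFields.YangMills.Theorems.SlackWindow

end
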